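import Mathlib
import HarnessLib
import HarnessLib.Audit
import Summits.ABC.Statement
import Summits.ABC.ABC.Theorems.IneffectiveSubspaceDeepRegimeABCOmegaTail
import HarnessLib.Audit.Status.Attr

/-!
Route: ThreeSlotCyclotomicDescent

# Route ThreeSlotCyclotomicDescent — a three-prime abc counterexample family must be rigid — the
non-rigid cell descends to named cyclotomic equations

Assume the opposite inside the deciding crux B₃ = `OmegaSplitFewPrime.ThreeSlotABC` (stmt-ABC-19048,
ω(abc) ≤ 3): an infinite
family of three-prime abc triples with quality ≥ 1+ε. Build it: if two of the three prime powers are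
ℓ-th powers for a common ℓ ≥ 2,
or one summand is 1, then Zsigmondy primitive divisors + the cyclotomic factorisation u^ℓ ± v^ℓ = (u
± v)·Φ + Catalan (Mihăilescu)
force the triple onto a short list of NAMED equations (Nagell–Ljunggren with Fermat-prime base,
(p^ℓ+1)/(p+1) = r^z with Mersenne
base, Φ_n(2) = r^z, consecutive-base (P+1)^ℓ − P^ℓ = q^y, Lebesgue–Nagell, Ljunggren, the
Wieferich-square wall), most of them
solved; so the counterexample family must be RIGID: p^x + q^y = r^z with pairwise coprime exponents
(prime Pillai r^z − q^y = p and
mixed hyperbolic signatures). It suffices to show X = RigidThreeSlotABC ∧ CyclotomicZooABC ∧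
FewPrimeUniformABC ∧ DeepRegimeABC:
the first two re-cut B₃ EXACTLY (complementary predicates), the last two are the shared items
stmt-ABC-19049 / stmt-ABC-15121
(residual) of route OmegaSplitFewPrime. No summit and no rung is proved by this line; it prices B₃
and isolates its hard core.
Lean: `Summit.ABC.ABC.Theses.ThreeSlotCyclotomicDescent.RigidThreeSlotABC ∧
Summit.ABC.ABC.Theses.ThreeSlotCyclotomicDescent.CyclotomicZooABC ∧
Summit.ABC.ABC.Theses.ThreeSlotCyclotomicDescent.FewPrimeUniformABC ∧
Summit.ABC.ABC.Theses.ThreeSlotCyclotomicDescent.DeepRegimeABC`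

## Assembly
Pure logic plus one tree theorem. The inlined rigidity predicate is decidable, so RigidThreeSlotABC
and CyclotomicZooABC give abc(ε) on the
whole cell ω(abc) ≤ 3 with constant max(C_R, C_Z) (`by_cases`);
`Summit.ABC.ABC.Theorems.DeepRegimeABC.omegaTail_of_deepRegimeABC`
(landed) turns DeepRegimeABC into abc on a tail ω(abc) ≥ W(ε); FewPrimeUniformABC covers 4 ≤ ω ≤ W;
the three constants are maxed
and `_root_.ABC_iff` closes. The deciding theorem `closes (hR) (hZ) (h₁) (h₂) : _root_.ABC` is
certified in glue.lean and uses all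
four binders (Sketch.lean `assembly_holds`, lean check rc 0).

Rationale: WHY THIS LINE. Mechanism: in the cell ω(abc) ≤ 3 every member of a triple with min(a,b) ≥ 2 is a
single prime power, so a + b = c reads
p^x + q^y = r^z; whenever two exponents share a factor ℓ ≥ 2 the identity factors through a
cyclotomic value with exactly one new
prime, and Zsigmondy (`Literature.NumberTheory.Congruences.ZsigmondyTheorem.zsigmondy`, in tree,
with its exceptions
`no_zsigmondy_prime_two_six`, `no_zsigmondy_prime_mersenne`) pins the base to {2, Fermat prime,
Mersenne prime} or to consecutive
bases {2^k, 2^k ± 1}; Catalan (Mihailescu2004) and the classical two-term results (Shorey–Tijdeman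
ch. 12,
book:shorey1986-exponential-diophantine-equations pp.166-178; Nagell–Ljunggren, Ljunggren x²+1 =
2y⁴, Lebesgue–Nagell x²+2^m = yⁿ,
Darmon–Merel on (ℓ,ℓ,2) and (ℓ,ℓ,3), DarmonMerel1997) then decide or name every sub-family; the
one-slot shapes 1 + p^x q^y = r^z and
1 + p^x = q^y r^z descend the same way through r^z − 1 = ∏_{d|z} Φ_d(r). Imported area: cyclotomic /
primitive-divisor arithmetic and
the modular method for (ℓ,ℓ,n) — absent from the 45 ABC theses, which treat ω ≤ 3 by linear forms in
logarithms (BakerWustholz2007,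
StewartYu2001: exponent bounds, c < exp(rad^{1/3+ε})) or by counting solutions per base triple
(ScottStyer2004 =
doi:10.1016/j.jnt.2003.11.008, arXiv:2206.14067, doi:10.3336/gm.59.2.02: count, not height). What it
does that OmegaSplitFewPrime /
NegOmegaAtlas do not: it splits their monolithic B₃ into a cell with theorem content now (the zoo)
and an honestly priced rigid core,
and its instrument E-3SLOT (all 19 triples with ω ≤ 3 and quality > 1 up to 10^10,
artifacts/E-3SLOT_1e10.txt; 10^13 running as
kit j293605) confirms the sorting: the 12 non-rigid champions are exactly Nagell–Ljunggren (243),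
Ljunggren (57122), Lebesgue–Nagell
(125), twin prime powers (81), consecutive-base (512 = 13²+7³), LTE squares (513, 1025) and the z ∈
{2,4,6} one-slot squares
(25, 49, 289, 81, 64); the 7 rigid champions (128 = 3+5³, 32768 = 7+181², 256, 131072, 2187, 5041 =
2⁷+17³, 32) are the residue
this line cannot touch and says so.

RANKED CRUXES. #2 RigidThreeSlotABC (crux) — abc with a constant C(ε), uniformly on abc triples with
ω(abc) ≤ 3, both summands ≥ 2 and the three prime-power exponents pairwise coprime (the RIGID cell:
prime Pillai p + q^y = r^z and mixed hyperbolic signatures such as (2,3,7): 2⁷ + 17³ = 71²). The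
hard core of B₃; priced, not claimed easier. [difficulty: open-problem] (why it might fail: it is
Pillai's conjecture with prime entries plus a height bound: r^z − q^y = p for infinitely many
(q,y,r,z) with quality ≥ 1+ε is consistent with everything known (Baker gives only z ≪ log-bounds
per (p,q,r); champions 3+5³=2⁷ q=1.4266, 7+181²=2¹⁵ q=1.3266).)
[book:shorey1986-exponential-diophantine-equations, ScottStyer2004, arXiv:2206.14067, StewartYu2001,
BakerWustholz2007]
#3 CyclotomicZooABC (crux) — abc with a constant C(ε), uniformly on abc triples with ω(abc) ≤ 3 that
are NOT rigid: the one-slot shapes 1 + p^x q^y = r^z and 1 + p^x = q^y r^z, and the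
three-prime-power triples p^x + q^y = r^z in which two exponents share a factor ℓ ≥ 2. Why easier:
Zsigmondy + cyclotomic factorisation + Catalan sort this cell onto named two-term equations, most of
them solved (Nagell–Ljunggren base-Fermat-prime y ≥ 3, (p^ℓ+1)/(p+1) = r^z, Φ_n(2) = r^z,
consecutive-base (ℓ,ℓ,y) with y ≥ 5 and the Wieferich-square wall 2^ℓ − 1 = p^x q^y, x ≥ 2 remain
open and are the price inside this crux). [difficulty: L] (why it might fail: the open residue of
the zoo is real: Nagell–Ljunggren (r^ℓ−1)/(r−1) = q^y with y ≥ 3, Φ_ℓ(2) = r^z with z ≥ 2 (⇔ a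
Wieferich-type square in 2^ℓ−1) and (2^k+1)^ℓ − 2^{kℓ} = q^y, y ≥ 5 are unsolved; an infinite
high-quality family there refutes the crux.) [Mihailescu2004, DarmonMerel1997,
book:shorey1986-exponential-diophantine-equations, BugeaudMignotteSiksek2006,
book:guy1994-unsolved-problems-number-theory]
#4 FewPrimeUniformABC (crux) — SHARED item stmt-ABC-19049 of route OmegaSplitFewPrime, verbatim: abc
with a constant C(W, ε) on every cell 4 ≤ ω(abc) ≤ W. [difficulty: open-problem] (why it might fail:
bounded-ω abc is open for every W ≥ 2 beyond counting results; Reyssat's 2 + 3¹⁰·109 = 23⁵ (ω = 4,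
quality 1.6299) shows the cell carries the record qualities, and Baker-type bounds lose a factor
exponential in W.) [doi:10.1016/j.jnt.2003.11.008, arXiv:2206.14067, EvertseGyory2015,
BakerWustholz2007, Pasten2024]
#5 DeepRegimeABC (crux) — SHARED residual item stmt-ABC-15121 (IneffectiveSubspace /
OmegaSplitFewPrime), verbatim: for every ε there are K and C with abc(ε, C) on all abc triples
having at least K primes of exponent ≥ 5 in abc. Declared RESIDUAL of this route (imported
complement, not attacked here). [difficulty: open-problem] (why it might fail: it is abc on a
co-finite-in-ω regime: any infinite family of abc triples with quality ≥ 1+ε and unboundedly many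
fifth-power primes refutes it; nothing beyond Stewart–Yu is known there.) [StewartYu2001,
Pasten2024, EvertseGyory2015]

TWO-LAYER PLAN. CyclotomicZooABC ⇐ OneSlotZooABC → CommonExponentZooABC → CyclotomicZooABC (glue =
case split on ¬RigidExp: a = 1 ∨ b = 1 ∨ two
exponents share ℓ ≥ 2; skeleton bc/CyclotomicZooABC_birth.lean). RigidThreeSlotABC ⇐ PrimePillaiABC
(one exponent = 1) →
ProperHyperbolicABC (all exponents ≥ 2, pairwise coprime) → RigidThreeSlotABC (skeleton
bc/RigidThreeSlotABC_birth.lean). Inside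
OneSlotZooABC the first rung is the square shape 1 + 2^x q^y = r² (difference of squares + the
elementary Catalan cases 2^m ± 1 = q^y),
sup quality 1.2252 at 289 = 1 + 2⁵·3².

KILL CRITERIA. Refuted outright (close --reason refuted:CyclotomicZooABC) by an infinite family, or
a growing-quality sequence, of NON-rigid ω ≤ 3
triples — equivalently an infinite family of perfect-power values among Φ_ℓ(F) (F Fermat prime),
(M^ℓ+1)/(M+1) (M Mersenne prime),
Φ_n(2), or (2^k±1)^ℓ ∓ 2^{kℓ} with quality bounded away from 1. A refutation of RigidThreeSlotABC
kills B₃ and hence abc itself (it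
is a sub-statement of the summit) — informative either way. Mooted if stmt-ABC-19048 (ThreeSlotABC)
is proved directly elsewhere.
Pivot: if the zoo's open residue (Nagell–Ljunggren y ≥ 3, Wieferich-square wall) turns out to carry
all the difficulty, re-cut
CyclotomicZooABC into solved-zoo (support, provable now) + NagellLjunggrenWall (crux).

NOT DECOMPOSED YET. The per-equation lemmas of the zoo (Catalan-lite 2^m ± 1 = q^y; r^z − 1 = 2^x
q^y via Φ_d(r); consecutive-base descent; LTE for
p^{2^a·m}+1) are layer-2 children / prover lemmas, not items; the constants C(ε) per sub-family are
not fixed at open; the rigid cell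
is deliberately NOT decomposed beyond the foreseen PrimePillai / ProperHyperbolic split because no
tool in hand bounds heights there.

CHEAPEST FALSIFIER. Instrument E-3SLOT (certified enumeration of all abc triples with ω(abc) ≤ 3 and
quality > 1): the row that kills the key lemma is
«a NON-rigid triple with quality > 1 outside the predicted solved/named families» or «non-rigid
qualities not decreasing with c».
Run: B = 10^10 (local, 42 s): 19 triples, all with c ≤ 131072, every one of the 12 non-rigid ones in
a predicted family, none in
(1.4·10^5, 10^10]; B = 10^13 running (kit j293605). For the rigid crux the cheapest adverse evidence
would be a new prime-Pillai
triple p + q^y = r^z with quality > 1.2 beyond 10^10 — none is known (Nitaj / de Weger tables,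
arXiv:2602.08051).

NUMBERS. Qualities (E-3SLOT, B = 10^10): rigid 1.4266 (3+5³=2⁷), 1.3266 (7+181²=2¹⁵), 1.2728
(13+3⁵=2⁸), 1.1486 (751+19⁴=2¹⁷), 1.1433
(139+2¹¹=3⁷), 1.0945 (2⁷+17³=71²), 1.0190 (5+3³=2⁵); non-rigid 1.3176 (1+2⁹=3³·19), 1.3111
(1+2·11²=3⁵), 1.2920 (1+2⁴·5=3⁴),
1.2540 (1+239²=2·13⁴), 1.2263 (1+2³=3²), 1.2252 (1+2⁵3²=17²), 1.1988 (13²+7³=2⁹), 1.1757 (2⁵+7²=3⁴),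
1.1523 (1+2¹⁰=5²·41),
1.1127 (1+3²·7=2⁶), 1.0412 (1+2⁴·3=7²), 1.0272 (2²+11²=5³). Known unconditional ceiling in the cell:
c < exp(C·rad^{1/3}(log rad)³)
(StewartYu2001); per fixed (p,q,r) at most two solutions of p^x + q^y = r^z (arXiv:2206.14067), at
most one in most ranges
(doi:10.3336/gm.59.2.02).

DEFINITION REQUESTS. None. The rigidity predicate is inlined in both crux statements: RigidExp a b c
:= 2 ≤ a ∧ 2 ≤ b ∧ the three exponents
expo a, expo b, expo c pairwise coprime, with expo n := Nat.log (Nat.minFac n) n (= e on a prime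
power p^e — the only case in which it is
read: inside ω(abc) ≤ 3 with a, b ≥ 2 every member is a prime power; decidable, instances by
norm_num). Zsigmondy, cyclotomic values
(`cyclEval`) and `IsABCTriple`/`rad` exist in Literature.

Novelty: Searches (2026-08-27): lit search --hybrid "exponential Diophantine equation prime bases p^x + q^y =
r^z Zsigmondy primitive divisor" (6 docs: [corpus:book:shorey1986-exponential-diophantine-equations
pp.16-19, 166-178], [corpus:book:guy1994-unsolved-problems-number-theory p.167]); lit search
--hybrid "Nagell-Ljunggren equation cyclotomic polynomial perfect power abc conjecture quality" (6
docs: [corpus:book:evertse2015-unit-equations-diophantine-number-theory pp.87-88],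
[corpus:book:lang1990-cyclotomic-fields-i-ii p.109]); lit vsearch "three-term equations in prime
powers reduced by primitive divisors to Catalan and Nagell–Ljunggren" (6 docs, none on abc quality);
lit galaxy search "Nagell-Ljunggren|Scott and Styer|p^x+q^y=r^z" --star all ([galaxy:pdf:2172197360]
Styer, at most one solution to a^x+b^y=c^z; [galaxy:pdf:-5874662963965043940] Bugeaud–Luca 2006 On
Pillai's equation (counts); [galaxy:pdf:-6412146244980180420] Göttingen thesis "Diophantine
equations and cyclotomic fields" (Nagell–Ljunggren via cyclotomic fields)); ledger negatives
--problem ABC (stmt-ABC-1205, 1689: unrelated); tree: OmegaSplitFewPrime, NegOmegaAtlas (docstring: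
common-exponent sub-families excluded by modularity), TwoSlotCell (Mihailescu, ω = 2), card
three-prime-powers-padic-exponent (p-adic/LFL exponent bounds).
Nearest prior art found: ScottStyer2004 = doi:10.1016/j.jnt.2003.11.008 and arXiv:2206.14067 (number
of solutions of p^x ± q^y = c / a^x + b^y = c^z per base triple — count, not height)  [refs: 10.1016/j.jnt.2003.11.008, 2206.14067, book:shorey1986-exponential-diophantine-equations, book:guy1994-unsolved-problems-number-theory, book:evertse2015-unit-equations-diophantine-number-theory, book:lang1990-cyclotomic-fields-i-ii, doi:10.1016/j.jnt.2003.11.008, ScottStyer2004, Mihailescu2004]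

Barriers (technique_class: cyclotomic-descent, zsigmondy, catalan, omega-split): - technique_class: cyclotomic-descent, zsigmondy, catalan, omega-split
- Literature.Barriers.ABC.BakerMethodBounds: CyclotomicZooABC sits OUTSIDE the linear-forms class —
no exponent bound is used; the descent is algebraic (primitive divisors, Φ-factorisation, Catalan,
modular (ℓ,ℓ,n)); RigidThreeSlotABC sits INSIDE it as typed (only LFL touches prime Pillai) and the
route does not claim to beat it there: that crux is priced, not attacked.
- Literature.Barriers.ABC.ExplicitABCQualityFloor: consistent — the route asserts no quality bound
below Reyssat's 1.6299 (ω = 4, inside FewPrimeUniformABC); in the three-prime cell the instrument's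
top quality is 1.4266 (3 + 5³ = 2⁷) and every item keeps C(ε).
- Literature.Barriers.ABC.EpsilonCannotBeDropped: all four items keep ε > 0 and a constant C(ε); the
ε-free witness families (ω unbounded, 3^{2^k}−1) have ω → ∞ and lie in FewPrimeUniformABC /
DeepRegimeABC cells with ε kept.
- Literature.Barriers.ABC.BakerShapeConstantFloor: not engaged — no Baker-shape constant K in c <
rad^K is claimed; the rigid cell, where only such bounds exist, is priced not attacked.
- Literature.Barriers.ABC.MasonStothersFailsInCharP: no function-field transfer is used.
- Literature.Barriers.ABC.IntegersHaveNoDerivation: no arithmetic derivative / Wronskian analogue is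
used; the descent is multiplicative (primitive divisors), not differential.
- Negatives index: stmt-ABC-1205 (Belyi uniformity) and stmt-ABC-1689 are not restated;
NegOmegaAtlas.ThreeSlotFamil

sub-problem: ABC · status: draft · opened planner-abc-idea-3-g2-0 2026-08-27T23:33:40Z · rev 1 · ledger route-ABC-ThreeSlotCyclotomicDescent
GENERATED by the gate from the ledger (D-0016/17). Provers cite these decls: `theorem foo : Summit.ABC.ABC.Theses.ThreeSlotCyclotomicDescent.<Decl> := …` in Summits/ABC/ABC/Theorems/<Name>.lean.
-/

namespace Summit.ABC.ABC.Theses.ThreeSlotCyclotomicDescent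

open scoped BigOperators Topology Manifold Classical MeasureTheory ProbabilityTheory Matrix InnerProductSpace ComplexConjugate ContinuousMap
open Filter Set Function TopologicalSpace MeasureTheory

attribute [summit_statement] _root_.ABC

open Literature.Abc

/-- item stmt-ABC-23676 · crux · rank 2 · open · by planner
why it might fail: it is Pillai's conjecture with prime entries plus a height bound: r^z − q^y = p for infinitely many (q,y,r,z) with quality ≥ 1+ε is consistent with everything known (Baker gives only z ≪ log-bounds per (p,q,r); champions 3+5³=2⁷ q=1.4266, 7+181²=2¹⁵ q=1.3266).
sources: book:shorey1986-exponential-diophantine-equations, ScottStyer2004, arXiv:2206.14067, StewartYu2001, BakerWustholz2007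
[crux] abc with a constant C(ε), uniformly on abc triples with ω(abc) ≤ 3, both summands ≥ 2 and the
three prime-power exponents pairwise coprime (the RIGID cell: prime Pillai p + q^y = r^z and mixed
hyperbolic signatures such as (2,3,7): 2⁷ + 17³ = 71²). The hard core of B₃; priced, not claimed
easier. [difficulty: open-problem] -/
@[route_item "route-ABC-ThreeSlotCyclotomicDescent", crux]
def RigidThreeSlotABC : Prop :=
  ∀ ε : ℝ, 0 < ε → ∃ C : ℝ, 0 < C ∧ ∀ a b c : ℕ, Literature.NumberTheory.DiophantineGeometry.IsABCTriple a b c → (a * b * c).primeFactors.card ≤ 3 → (2 ≤ a ∧ 2 ≤ b ∧ Nat.Coprime (Nat.log a.minFac a) (Nat.log b.minFac b) ∧ Nat.Coprime (Nat.log a.minFac a) (Nat.log c.minFac c) ∧ Nat.Coprime (Nat.log b.minFac b) (Nat.log c.minFac c)) → (c : ℝ) < C * ((Literature.NumberTheory.DiophantineGeometry.rad a b c : ℕ) : ℝ) ^ (1 + ε)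

/-- item stmt-ABC-23677 · crux · rank 3 · SPLIT (gen 1) into ZooSorting, SolvedZooABC, ZooWallsABC + glue CyclotomicZooABC_of_split · direct attempts still welcome (low priority) · by planner
why it might fail: the open residue of the zoo is real: Nagell–Ljunggren (r^ℓ−1)/(r−1) = q^y with y ≥ 3, Φ_ℓ(2) = r^z with z ≥ 2 (⇔ a Wieferich-type square in 2^ℓ−1) and (2^k+1)^ℓ − 2^{kℓ} = q^y, y ≥ 5 are unsolved; an infinite high-quality family there refutes the crux.
sources: Mihailescu2004, DarmonMerel1997, book:shorey1986-exponential-diophantine-equations, BugeaudMignotteSiksek2006, book:guy1994-unsolved-problems-number-theory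
[crux] abc with a constant C(ε), uniformly on abc triples with ω(abc) ≤ 3 that are NOT rigid: the
one-slot shapes 1 + p^x q^y = r^z and 1 + p^x = q^y r^z, and the three-prime-power triples p^x + q^y
= r^z in which two exponents share a factor ℓ ≥ 2. Why easier: Zsigmondy + cyclotomic factorisation
+ Catalan sort this cell onto named two-term equations, most of them solved (Nagell–Ljunggren
base-Fermat-prime y ≥ 3, (p^ℓ+1)/(p+1) = r^z, Φ_n(2) = r^z, consecutive-base (ℓ,ℓ,y) with y ≥ 5 and
the Wieferich-square wall 2^ℓ − 1 = p^x q^y, x ≥ 2 remain open and are the price inside this crux).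
[difficulty: L] -/
@[route_item "route-ABC-ThreeSlotCyclotomicDescent", crux]
def CyclotomicZooABC : Prop :=
  ∀ ε : ℝ, 0 < ε → ∃ C : ℝ, 0 < C ∧ ∀ a b c : ℕ, Literature.NumberTheory.DiophantineGeometry.IsABCTriple a b c → (a * b * c).primeFactors.card ≤ 3 → ¬ (2 ≤ a ∧ 2 ≤ b ∧ Nat.Coprime (Nat.log a.minFac a) (Nat.log b.minFac b) ∧ Nat.Coprime (Nat.log a.minFac a) (Nat.log c.minFac c) ∧ Nat.Coprime (Nat.log b.minFac b) (Nat.log c.minFac c)) → (c : ℝ) < C * ((Literature.NumberTheory.DiophantineGeometry.rad a b c : ℕ) : ℝ) ^ (1 + ε)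

-- parent: CyclotomicZooABC · child (gen 1)
/--     item stmt-ABC-24024 · crux · rank 301 · closed · proved by Summit.ABC.ABC.Theorems.zooSorting_proof (prover)
    parent: CyclotomicZooABC · by planner
    why it might fail: a sub-shape missed by the case analysis (the LTE-emptiness of R^ℓ − A^ℓ = q^y with q ∣ R−A, of A^ℓ + B^ℓ = r^z, or of 1 + p^x = 2^y r^z with r ∣ p+1) would leave a triple with c > 5·rad outside L1–L4 ∪ W1–W4; E-3SLOT to 1e13 shows none.
    sources: Mihailescu2004, book:shorey1986-exponential-diophantine-equations, BugeaudMignotteSiksek2006, DarmonMerel1997, job:j293605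
[crux · SORTING · ε-free structure theorem, provable now] Every abc triple with ω(abc) ≤ 3 that is
NOT rigid satisfies c ≤ 5·rad(abc) outright, or lies (up to swapping a,b) in one of four
SOLVED-IN-PRINT families — L1: a = 4^u, b = q^{2v}, c = r^z, z ≥ 3 (x² + 2^k = yⁿ); L2: 1 + p^{2u} =
2·r^z, z ≥ 4 even (x² + 1 = 2y^{2m}: Ljunggren / Pell perfect powers); L3: 1 + 2^x q² = r^z, r,z
odd, z ≥ 3 (Nagell–Ljunggren with y = 2); L4: A^ℓ + q^y = (A+1)^ℓ, ℓ ≥ 5, 2∣y or 3∣y (Darmon–Merel)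
— or in one of six OPEN wall families — W1: 1 + 2^x q^y = r^z, r,z odd, z ≥ 3, y ≥ 3
(Nagell–Ljunggren y ≥ 3); W1b: 1 + p^x = 2^y r^z, p,x odd, x ≥ 3, z ≥ 2 ((p^x+1)/(p+1) = r^z type);
W2a: 2^z − 1 = p^x q^y, z odd ≥ 3; W2b: 2^x + 1 = p^y q^z with max(y,z) ≥ 2 (Wieferich-type powerful
part); W3: A^ℓ + q^y = (A+1)^ℓ, ℓ ≥ 3, y ≥ 2, 3∤y, (ℓ = 3 ∨ 2∤y) (consecutive-base open part:
Pell-conic powers 3A²+3A+1 = q^y and signature (ℓ,ℓ,y), gcd(y,6)=1); W4: 1 + p^{2u} = 2 r^z with (z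
odd ≥ 3) or (z = 2 ∧ u ≥ 2) (x²+1 = 2yⁿ odd n / NSW perfect powers). PROOF PLAN (in-tree tools only,
long casework): two-slot cell (NegOmegaAtlas.TwoSlotCell: c < 2·rad); landed rungs
ThreeSlotZooSquareRung.zooSquareRung, ThreeSlotZoo -/
@[route_item "route-ABC-ThreeSlotCyclotomicDescent"]
def ZooSorting : Prop :=
  ∀ a b c : ℕ, Literature.NumberTheory.DiophantineGeometry.IsABCTriple a b c → (a * b * c).primeFactors.card ≤ 3 → ¬ (2 ≤ a ∧ 2 ≤ b ∧ Nat.Coprime (Nat.log a.minFac a) (Nat.log b.minFac b) ∧ Nat.Coprime (Nat.log a.minFac a) (Nat.log c.minFac c) ∧ Nat.Coprime (Nat.log b.minFac b) (Nat.log c.minFac c)) → c ≤ 5 * Literature.NumberTheory.DiophantineGeometry.rad a b c ∨ (((∃ u v q r z : ℕ, q.Prime ∧ r.Prime ∧ 1 ≤ u ∧ 1 ≤ v ∧ 3 ≤ z ∧ a = 2 ^ (2 * u) ∧ b = q ^ (2 * v) ∧ c = r ^ z) ∨ (∃ u p r z : ℕ, p.Prime ∧ r.Prime ∧ 1 ≤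 u ∧ 4 ≤ z ∧ Even z ∧ a = 1 ∧ b = p ^ (2 * u) ∧ c = 2 * r ^ z) ∨ (∃ x q r z : ℕ, q.Prime ∧ r.Prime ∧ Odd r ∧ Odd z ∧ 3 ≤ z ∧ a = 1 ∧ b = 2 ^ x * q ^ 2 ∧ c = r ^ z) ∨ (∃ A l q y : ℕ, q.Prime ∧ 5 ≤ l ∧ 2 ≤ y ∧ (2 ∣ y ∨ 3 ∣ y) ∧ a = A ^ l ∧ b = q ^ y ∧ c = (A + 1) ^ l)) ∨ ((∃ u v q r z : ℕ, q.Prime ∧ r.Prime ∧ 1 ≤ u ∧ 1 ≤ v ∧ 3 ≤ z ∧ b = 2 ^ (2 * u) ∧ a = q ^ (2 * v) ∧ c = r ^ z) ∨ (∃ u p r z : ℕ, p.Prime ∧ r.Prime ∧ 1 ≤ u ∧ 4 ≤ z ∧ Even z ∧ b = 1 ∧ a = p ^ (2 * u) ∧ c = 2 * r ^ z) ∨ (∃ x q r z : ℕ, q.Prime ∧ r.Prime ∧ Odd r ∧ Odd z ∧ 3 ≤ z ∧ b = 1 ∧ a = 2 ^ x * q ^ 2 ∧ c = r ^ z) ∨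 (∃ A l q y : ℕ, q.Prime ∧ 5 ≤ l ∧ 2 ≤ y ∧ (2 ∣ y ∨ 3 ∣ y) ∧ b = A ^ l ∧ a = q ^ y ∧ c = (A + 1) ^ l))) ∨ (((∃ x y q r z : ℕ, q.Prime ∧ r.Prime ∧ Odd r ∧ Odd z ∧ 3 ≤ z ∧ 3 ≤ y ∧ a = 1 ∧ b = 2 ^ x * q ^ y ∧ c = r ^ z) ∨ (∃ x y p r z : ℕ, p.Prime ∧ r.Prime ∧ Odd p ∧ Odd x ∧ 3 ≤ x ∧ 1 ≤ y ∧ 2 ≤ z ∧ a = 1 ∧ b = p ^ x ∧ c = 2 ^ y * r ^ z) ∨ (∃ x y z p q : ℕ, p.Prime ∧ q.Prime ∧ p ≠ q ∧ 1 ≤ x ∧ 1 ≤ y ∧ Odd z ∧ 3 ≤ z ∧ a = 1 ∧ b = p ^ x * q ^ y ∧ c = 2 ^ z) ∨ (∃ x y z p q : ℕ, p.Prime ∧ q.Prime ∧ p ≠ q ∧ 2 ≤ max y z ∧ a = 1 ∧ b = 2 ^ x ∧ c = p ^ y * q ^ z) ∨ (∃ A l q y : ℕ, q.Prime ∧ 3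 ≤ l ∧ 2 ≤ y ∧ ¬ 3 ∣ y ∧ (l = 3 ∨ ¬ 2 ∣ y) ∧ a = A ^ l ∧ b = q ^ y ∧ c = (A + 1) ^ l) ∨ (∃ u p r z : ℕ, p.Prime ∧ r.Prime ∧ 1 ≤ u ∧ a = 1 ∧ b = p ^ (2 * u) ∧ c = 2 * r ^ z ∧ ((3 ≤ z ∧ Odd z) ∨ (z = 2 ∧ 2 ≤ u)))) ∨ ((∃ x y q r z : ℕ, q.Prime ∧ r.Prime ∧ Odd r ∧ Odd z ∧ 3 ≤ z ∧ 3 ≤ y ∧ b = 1 ∧ a = 2 ^ x * q ^ y ∧ c = r ^ z) ∨ (∃ x y p r z : ℕ, p.Prime ∧ r.Prime ∧ Odd p ∧ Odd x ∧ 3 ≤ x ∧ 1 ≤ y ∧ 2 ≤ z ∧ b = 1 ∧ a = p ^ x ∧ c = 2 ^ y * r ^ z) ∨ (∃ x y z p q : ℕ, p.Prime ∧ q.Prime ∧ p ≠ q ∧ 1 ≤ x ∧ 1 ≤ y ∧ Odd z ∧ 3 ≤ z ∧ b = 1 ∧ a = p ^ x * q ^ y ∧ c = 2 ^ z) ∨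 (∃ x y z p q : ℕ, p.Prime ∧ q.Prime ∧ p ≠ q ∧ 2 ≤ max y z ∧ b = 1 ∧ a = 2 ^ x ∧ c = p ^ y * q ^ z) ∨ (∃ A l q y : ℕ, q.Prime ∧ 3 ≤ l ∧ 2 ≤ y ∧ ¬ 3 ∣ y ∧ (l = 3 ∨ ¬ 2 ∣ y) ∧ b = A ^ l ∧ a = q ^ y ∧ c = (A + 1) ^ l) ∨ (∃ u p r z : ℕ, p.Prime ∧ r.Prime ∧ 1 ≤ u ∧ b = 1 ∧ a = p ^ (2 * u) ∧ c = 2 * r ^ z ∧ ((3 ≤ z ∧ Odd z) ∨ (z = 2 ∧ 2 ≤ u)))))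

-- `ZooSorting` holds: proved by `Summit.ABC.ABC.Theorems.zooSorting_proof` (its module imports this route file, so no `_holds` link can be stated here).

-- parent: CyclotomicZooABC · child (gen 1)
/--     item stmt-ABC-24025 · crux · rank 302 · open
    parent: CyclotomicZooABC · by planner
    why it might fail: a cited complete-solution theorem may be narrower than the typed family (x² + 2^k = yⁿ: parity side-conditions on x,k across Cohn/Arif–Abu Muriefah/Le; Darmon–Merel needs primitivity and n ≥ 4 for squares — typed ℓ ≥ 5, 2∣y ∨ 3∣y), leaving a sub-family that is really a wall.
    sources: BugeaudMignotteSiksek2006, DarmonMerel1997, book:shorey1986-exponential-diophantine-equations, book:guy1994-unsolved-problems-number-theory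
[crux · SOLVED FAMILIES · modulo named facts] abc(ε) with a constant C(ε) on the four
solved-in-print families L1–L4 of the sorting (both orientations). Each has a COMPLETE solution list
in print, after which abc with an explicit constant is a finite check: L1 x² + 2^k = yⁿ, n ≥ 3, x
odd: (x,k,y,n) ∈ {(5,1,3,3), (7,5,3,4), (11,2,5,3)} (Cohn 1992 k odd; Arif–Abu Muriefah 1997 / Le
2002 k even; 1 ≤ C ≤ 100 re-derived in Bugeaud–Mignotte–Siksek 2006) ⇒ members (4,121,125) [and
(32,49,81), (2,25,27) outside this cell's use]; L2 perfect powers in the Pell sequence: only 169 =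
13² (Ljunggren 1942; Pethő 1992; Cohn 1996) ⇒ (1, 57121, 57122) only; L3 (xⁿ − 1)/(x − 1) = y²: only
(x,n) = (7,4), (3,5) (Ljunggren 1943) ⇒ (1, 242, 243) only; L4 xⁿ + yⁿ = z² (n ≥ 4) and xⁿ + yⁿ = z³
(n ≥ 3) have no non-trivial primitive solutions (Darmon–Merel 1997) ⇒ empty. Provable once these
four results are typed as Literature named facts (the desk decides which are worth ONE Literature
proposal each; until then the item is carried modulo facts — a prover may close the L2/L3/L4-empty
parts that reduce to in-tree Catalan where possible). bears_on: stmt-ABC-23677. [difficulty: M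
modulo facts; the facts themsel -/
@[route_item "route-ABC-ThreeSlotCyclotomicDescent"]
def SolvedZooABC : Prop :=
  ∀ ε : ℝ, 0 < ε → ∃ C : ℝ, 0 < C ∧ ∀ a b c : ℕ, Literature.NumberTheory.DiophantineGeometry.IsABCTriple a b c → (((∃ u v q r z : ℕ, q.Prime ∧ r.Prime ∧ 1 ≤ u ∧ 1 ≤ v ∧ 3 ≤ z ∧ a = 2 ^ (2 * u) ∧ b = q ^ (2 * v) ∧ c = r ^ z) ∨ (∃ u p r z : ℕ, p.Prime ∧ r.Prime ∧ 1 ≤ u ∧ 4 ≤ z ∧ Even z ∧ a = 1 ∧ b = p ^ (2 * u) ∧ c = 2 * r ^ z) ∨ (∃ x q r z : ℕ, q.Prime ∧ r.Prime ∧ Odd r ∧ Odd z ∧ 3 ≤ z ∧ a = 1 ∧ b = 2 ^ x * q ^ 2 ∧ c = r ^ z) ∨ (∃ A l q y : ℕ, q.Prime ∧ 5 ≤ l ∧ 2 ≤ y ∧ (2 ∣ y ∨ 3 ∣ y) ∧ a = A ^ l ∧ b = q ^ y ∧ c = (A + 1) ^ l)) ∨ ((∃ u v q r z : ℕ, q.Prime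 ∧ r.Prime ∧ 1 ≤ u ∧ 1 ≤ v ∧ 3 ≤ z ∧ b = 2 ^ (2 * u) ∧ a = q ^ (2 * v) ∧ c = r ^ z) ∨ (∃ u p r z : ℕ, p.Prime ∧ r.Prime ∧ 1 ≤ u ∧ 4 ≤ z ∧ Even z ∧ b = 1 ∧ a = p ^ (2 * u) ∧ c = 2 * r ^ z) ∨ (∃ x q r z : ℕ, q.Prime ∧ r.Prime ∧ Odd r ∧ Odd z ∧ 3 ≤ z ∧ b = 1 ∧ a = 2 ^ x * q ^ 2 ∧ c = r ^ z) ∨ (∃ A l q y : ℕ, q.Prime ∧ 5 ≤ l ∧ 2 ≤ y ∧ (2 ∣ y ∨ 3 ∣ y) ∧ b = A ^ l ∧ a = q ^ y ∧ c = (A + 1) ^ l))) → (c : ℝ) < C * ((Literature.NumberTheory.DiophantineGeometry.rad a b c : ℕ) : ℝ) ^ (1 + ε)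

-- parent: CyclotomicZooABC · child (gen 1)
/--     item stmt-ABC-24026 · crux · rank 303 · open
    parent: CyclotomicZooABC · by planner
    why it might fail: these are open problems (N–L with y ≥ 3, prime-power factorisations of 2ⁿ ± 1, generalized Fermat (ℓ,ℓ,y), x² + 1 = 2yⁿ odd n); nothing short of abc-strength input bounds them uniformly, and one wall could carry an infinite quality-(1+δ) family.
    sources: book:shorey1986-exponential-diophantine-equations, book:guy1994-unsolved-problems-number-theory, DarmonMerel1997, BugeaudMignotteSiksek2006, Mihailescu2004
[crux · DECLARED RESIDUE · open, 0 provers] abc(ε) with a constant on the six wall families W1, W1b,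
W2a, W2b, W3, W4 of the sorting (both orientations) — the honest open remainder of the ω ≤ 3 zoo:
Nagell–Ljunggren (r^z − 1)/(r − 1) = q^y with y ≥ 3 (W1) and the negative-base shape (p^x + 1)/(p +
1) = r^z (inside W1b); two-prime-power Mersenne/Fermat numbers 2^z − 1 = p^x q^y (z odd) and 2^x + 1
= p^y q^z with a square factor (W2, Wieferich-type); consecutive-base (A+1)^ℓ − A^ℓ = q^y beyond
Darmon–Merel (W3: ℓ = 3 Pell-conic perfect powers 3A² + 3A + 1 = q^y, and signature (ℓ,ℓ,y) with
gcd(y,6) = 1); x² + 1 = 2yⁿ with n odd ≥ 3 and NSW perfect powers (W4). Each is a named open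
exponential Diophantine problem; this item is a consequence of ABC, is the declared residual of the
split and is NOT to be staffed. Instrument row that would refute it: an infinite subfamily of one
wall with quality ≥ 1 + δ (E-3SLOT to 1e13: wall members 513, 1025 (W2b), 169+343 = 512 (W3) all
have c ≤ 5·rad; no wall member of quality > 1 beyond 1025). bears_on: stmt-ABC-23677. [difficulty:
OPEN — residue, no provers] -/
@[route_item "route-ABC-ThreeSlotCyclotomicDescent"]
def ZooWallsABC : Prop :=
  ∀ ε : ℝ, 0 < ε → ∃ C : ℝ, 0 < C ∧ ∀ a b c : ℕ, Literature.NumberTheory.DiophantineGeometry.IsABCTriple a b c → (((∃ x y q r z : ℕ, q.Prime ∧ r.Prime ∧ Odd r ∧ Odd z ∧ 3 ≤ z ∧ 3 ≤ y ∧ a = 1 ∧ b = 2 ^ x * q ^ y ∧ c = r ^ z) ∨ (∃ x y p r z : ℕ, p.Prime ∧ r.Prime ∧ Odd p ∧ Odd x ∧ 3 ≤ x ∧ 1 ≤ y ∧ 2 ≤ z ∧ a = 1 ∧ b = p ^ x ∧ c = 2 ^ y * r ^ z) ∨ (∃ x y z p q : ℕ, p.Prime ∧ q.Prime ∧ p ≠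 q ∧ 1 ≤ x ∧ 1 ≤ y ∧ Odd z ∧ 3 ≤ z ∧ a = 1 ∧ b = p ^ x * q ^ y ∧ c = 2 ^ z) ∨ (∃ x y z p q : ℕ, p.Prime ∧ q.Prime ∧ p ≠ q ∧ 2 ≤ max y z ∧ a = 1 ∧ b = 2 ^ x ∧ c = p ^ y * q ^ z) ∨ (∃ A l q y : ℕ, q.Prime ∧ 3 ≤ l ∧ 2 ≤ y ∧ ¬ 3 ∣ y ∧ (l = 3 ∨ ¬ 2 ∣ y) ∧ a = A ^ l ∧ b = q ^ y ∧ c = (A + 1) ^ l) ∨ (∃ u p r z : ℕ, p.Prime ∧ r.Prime ∧ 1 ≤ u ∧ a = 1 ∧ b = p ^ (2 * u) ∧ c = 2 * r ^ z ∧ ((3 ≤ z ∧ Odd z) ∨ (z = 2 ∧ 2 ≤ u)))) ∨ ((∃ x y q r z : ℕ, q.Prime ∧ r.Prime ∧ Odd r ∧ Odd z ∧ 3 ≤ z ∧ 3 ≤ y ∧ b = 1 ∧ a = 2 ^ x * q ^ y ∧ c = r ^ z) ∨ (∃ x y p r z : ℕ, p.Prime ∧ r.Prime ∧ Odd p ∧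 Odd x ∧ 3 ≤ x ∧ 1 ≤ y ∧ 2 ≤ z ∧ b = 1 ∧ a = p ^ x ∧ c = 2 ^ y * r ^ z) ∨ (∃ x y z p q : ℕ, p.Prime ∧ q.Prime ∧ p ≠ q ∧ 1 ≤ x ∧ 1 ≤ y ∧ Odd z ∧ 3 ≤ z ∧ b = 1 ∧ a = p ^ x * q ^ y ∧ c = 2 ^ z) ∨ (∃ x y z p q : ℕ, p.Prime ∧ q.Prime ∧ p ≠ q ∧ 2 ≤ max y z ∧ b = 1 ∧ a = 2 ^ x ∧ c = p ^ y * q ^ z) ∨ (∃ A l q y : ℕ, q.Prime ∧ 3 ≤ l ∧ 2 ≤ y ∧ ¬ 3 ∣ y ∧ (l = 3 ∨ ¬ 2 ∣ y) ∧ b = A ^ l ∧ a = q ^ y ∧ c = (A + 1) ^ l) ∨ (∃ u p r z : ℕ, p.Prime ∧ r.Prime ∧ 1 ≤ u ∧ b = 1 ∧ a = p ^ (2 * u) ∧ c = 2 * r ^ z ∧ ((3 ≤ z ∧ Odd z) ∨ (z = 2 ∧ 2 ≤ u))))) → (c : ℝ) < C * ((Literature.NumberTheory.DiophantineGeometry.rad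 a b c : ℕ) : ℝ) ^ (1 + ε)

-- parent: CyclotomicZooABC · glue (gen 1)
/--     item stmt-ABC-24027 · support · rank 304 · open
    parent: CyclotomicZooABC · GLUE: children ⟹ parent · by planner
case split of the zoo: ZooSorting sorts every non-rigid ω ≤ 3 triple into (c ≤ 5·rad ⇒ c <
6·rad^{1+ε}) ∨ solved family (SolvedZooABC gives C_L) ∨ wall (ZooWallsABC gives C_W); take C =
max(6, C_L, C_W). Proved in the planner folder (recut/Recut.lean: cyclotomicZooABC_of_recut, lean
check rc 0, 0 sorries) and to be landed as a Theorems file closing this glue item. -/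
@[route_item "route-ABC-ThreeSlotCyclotomicDescent"]
def CyclotomicZooABC_of_split : Prop :=
  ZooSorting → SolvedZooABC → ZooWallsABC → CyclotomicZooABC

/-- item stmt-ABC-19049 · crux · rank 4 · open · by planner
why it might fail: bounded-ω abc is open for every W ≥ 2 beyond counting results; Reyssat's 2 + 3¹⁰·109 = 23⁵ (ω = 4, quality 1.6299) shows the cell carries the record qualities, and Baker-type bounds lose a factor exponential in W.
sources: doi:10.1016/j.jnt.2003.11.008, arXiv:2206.14067, EvertseGyory2015, BakerWustholz2007, Pasten2024
[crux] for every W and ε > 0 a constant C(W, ε) with c < C·rad(abc)^(1+ε) for every abc triple with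
4 ≤ ω(abc) ≤ W (abc on every bounded-ω cell above the three-prime cell; with B₃ this is
BoundedOmegaABC = ¬NegOmegaAtlas.NegThesis, stmt-ABC-1224); card omega-ladder-free-constants rungs
X_k, k ≥ 4. [difficulty: open-problem] -/
@[route_item "route-ABC-ThreeSlotCyclotomicDescent", crux]
def FewPrimeUniformABC : Prop :=
  ∀ W : ℕ, ∀ ε : ℝ, 0 < ε → ∃ C : ℝ, 0 < C ∧ ∀ a b c : ℕ, Literature.NumberTheory.DiophantineGeometry.IsABCTriple a b c → 4 ≤ (a * b * c).primeFactors.card → (a * b * c).primeFactors.card ≤ W → (c : ℝ) < C * ((Literature.NumberTheory.DiophantineGeometry.rad a b c : ℕ) : ℝ) ^ (1 + ε)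

/-- item stmt-ABC-15121 · crux · rank 5 · open · by planner
why it might fail: it is abc on a co-finite-in-ω regime: any infinite family of abc triples with quality ≥ 1+ε and unboundedly many fifth-power primes refutes it; nothing beyond Stewart–Yu is known there.
sources: StewartYu2001, Pasten2024, EvertseGyory2015
[crux, rank 6 — the DEEP-TAIL RESIDUE; hypothesis-free restatement (rev 8) of DepthUniformity
stmt-ABC-14939 after crux ideas deep-regime-complement / deep-tail-escape] abc on an ε-DEPENDENT
deep tail: for every ε > 0 there are K and C such that every abc triple with ω₅(abc) := #{p : p⁵ ∣
abc} ≥ K satisfies c < C·rad(abc)^(1+ε). POSITION: implied by ABC (K = 0); with crux #5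
DepthCountedABC it gives ABC by a case split at the single cell K(ε) (this is `closes`); conversely
#5 ∧ (#5 → ABC) ⟹ ABC ⟹ this, so GIVEN #5 it is equivalent to the old residue #5 → ABC (lossless
re-cut); in full ABC ⟺ DeepRegimeABC ∧ abc-on-{ω(abc) ≤ W} (one quintic breeding;
Cruxes/DepthUniformity/SketchIdeator1.lean) and #5 ⟹ the latter (ω₅ ≤ ω). Equivalent to its
constant-free form (C = 1: ω₅ ≥ K forces rad ≥ p_K#) and to 'quality → ≤ 1 along every sequence of
triples with ω₅ → ∞'. WHY ∃K(ε) AND NOT A FIXED CELL: every {ω₅ ≥ K₀} is abc-complete by Belyi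
breeding, but a degree-d Belyi map forces ≤ (2d−2)/4 new 5-deep primes at exponent cost
(1+ε′)/(1−(d−1)ε′), so tails with K(ε) ≥ 1/(2ε) are unreachable by identities
(Cruxes/DepthUniformity/BarrierNotes-r1-k2.md N1); Robert–Stewart–Tenenbaum Conj. A predict -/
@[route_item "route-ABC-ThreeSlotCyclotomicDescent", crux]
def DeepRegimeABC : Prop :=
  ∀ ε : ℝ, 0 < ε → ∃ K : ℕ, ∃ C : ℝ, 0 < C ∧ ∀ a b c : ℕ, Literature.NumberTheory.DiophantineGeometry.IsABCTriple a b c → K ≤ ((a * b * c).primeFactors.filter (fun p => 5 ≤ (a * b * c).factorization p)).card → (c : ℝ) < C * ((Literature.NumberTheory.DiophantineGeometry.rad a b c : ℕ) : ℝ) ^ (1 + ε)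

/-- item stmt-ABC-23678 · assembly · rank 1 · open · by planner
sources: EvertseGyory2015, Pasten2024
[assembly] RigidThreeSlotABC → CyclotomicZooABC → FewPrimeUniformABC → DeepRegimeABC → abc (the
ω-split of OmegaSplitFewPrime with B₃ re-cut as rigid ∧ zoo). -/
@[route_item "route-ABC-ThreeSlotCyclotomicDescent"]
def Assembly : Prop :=
  Summit.ABC.ABC.Theses.ThreeSlotCyclotomicDescent.RigidThreeSlotABC → Summit.ABC.ABC.Theses.ThreeSlotCyclotomicDescent.CyclotomicZooABC → Summit.ABC.ABC.Theses.ThreeSlotCyclotomicDescent.FewPrimeUniformABC → Summit.ABC.ABC.Theses.ThreeSlotCyclotomicDescent.DeepRegimeABC → _root_.ABC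

/-! D-0027 §2.1 — DECIDING THEOREM (planner-authored via `route open/edit --closes-file`; by planner-abc-idea-3-g2-0 2026-08-27T23:33:41Z):
its hypotheses are this route's items and its conclusion the sub-problem Statement (glue_lint), and it elaborates with this file. -/

@[closes "route-ABC-ThreeSlotCyclotomicDescent"] theorem closes (h_RigidThreeSlotABC : RigidThreeSlotABC) (h_CyclotomicZooABC : CyclotomicZooABC)
    (h_FewPrimeUniformABC : FewPrimeUniformABC) (h_DeepRegimeABC : DeepRegimeABC) : _root_.ABC := by
  rw [_root_.ABC_iff]
  intro ε hε
  obtain ⟨W, C₂, hC₂, hTail⟩ :=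
    Summit.ABC.ABC.Theorems.DeepRegimeABC.omegaTail_of_deepRegimeABC h_DeepRegimeABC ε hε
  obtain ⟨C₁, hC₁, hMid⟩ := h_FewPrimeUniformABC W ε hε
  obtain ⟨C_R, hC_R, hRig⟩ := h_RigidThreeSlotABC ε hε
  obtain ⟨C_Z, hC_Z, hZoo⟩ := h_CyclotomicZooABC ε hε
  refine ⟨max (max C_R C_Z) (max C₁ C₂), lt_max_of_lt_left (lt_max_of_lt_left hC_R), fun a b c habc => ?_⟩
  have hr : (0 : ℝ) ≤ ((Literature.NumberTheory.DiophantineGeometry.rad a b c : ℕ) : ℝ) ^ (1 + ε) :=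
    Real.rpow_nonneg (Nat.cast_nonneg _) _
  rcases le_or_gt (a * b * c).primeFactors.card 3 with h3 | h3
  · by_cases hrig : (2 ≤ a ∧ 2 ≤ b ∧ Nat.Coprime (Nat.log a.minFac a) (Nat.log b.minFac b) ∧
        Nat.Coprime (Nat.log a.minFac a) (Nat.log c.minFac c) ∧ Nat.Coprime (Nat.log b.minFac b) (Nat.log c.minFac c))
    · exact (hRig a b c habc h3 hrig).trans_le
        (mul_le_mul_of_nonneg_right ((le_max_left _ _).trans (le_max_left _ _)) hr)
    · exact (hZoo a b c habc h3 hrig).trans_le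
        (mul_le_mul_of_nonneg_right ((le_max_right _ _).trans (le_max_left _ _)) hr)
  · rcases le_or_gt (a * b * c).primeFactors.card W with hW | hW
    · exact (hMid a b c habc (by omega) hW).trans_le
        (mul_le_mul_of_nonneg_right ((le_max_left _ _).trans (le_max_right _ _)) hr)
    · exact (hTail a b c habc hW.le).trans_le
        (mul_le_mul_of_nonneg_right ((le_max_right _ _).trans (le_max_right _ _)) hr)

end Summit.ABC.ABC.Theses.ThreeSlotCyclotomicDescent
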